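import Summits.Ventures.HSemireg.WedgeHankelRecurrenceRouthHurwitzDeterminants
import Literature.LinearAlgebra.Matrix.SylvesterCriterion

/-!
# Venture HSemireg — HURWITZ STABILITY OF A COMPLEX POLYNOMIAL BY THE LEADING MINORS OF ITS HERMITE–FUJIWARA MATRIX (Fuhrmann–Helmke 2015 Thm 5.53 + Sylvester's criterion): **for `p ∈ ℂ[z]`
# of degree `n`, all roots lie in `Re z < 0` iff `det H_k(p) > 0` for `k = 1, …, n`**, `H_k(p)` the `k × k` Hermite–Fujiwara matrix (= the leading block of `H_n(p)`) — Hermite's determinants,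
# the complex-coefficient counterpart of the Hurwitz determinants `Δ_k` (N211); and the same for real `p` next to `Δ_k`

HONEST FRAMING. Part of the Lean index of the computation cell `pub-hsemireg` (seat p10 gen 39, Sunday typer «UNIFORM-IN-n»).
HERMITIAN MATRICES AND THEIR LEADING MINORS ONLY (PROVED Literature `LinearAlgebra/Matrix/SylvesterCriterion.posDef_iff_leadingMinors_pos` for `RCLike 𝕜` IMPORTED; N183 `hermiteFujiwara`,
N186 `posDef_hermiteFujiwara_iff`, N187 `posDef_hermiteFujiwara_real_iff`): no variety, no cohomology theory, no sheaf, no Ext group and no semiregularity map is constructed here; nothing here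
says that HC / HC_CM / HC_AV holds; no Literature fact (unproved `Prop`) is declared or used.  Custodian versions as in `WedgeHankelSiegelIdeal` (1/3).
SOURCES (cited).  P. A. Fuhrmann, U. Helmke, *The Mathematics of Networks of Linear Systems* (2015) §5.5 Thm 5.53 («`p` is a Hurwitz polynomial iff the Hermite–Fujiwara matrix `H_n(p)` is
positive definite», typed N186); R. A. Horn, C. R. Johnson, *Matrix Analysis* (2nd ed.) Thm 7.2.5 (b) (Sylvester's criterion; Literature); C. Hermite, *Sur le nombre des racines d'une équation
algébrique comprise entre des limites données*, J. reine angew. Math. 52 (1856) — Hermite's determinantal stability test.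
DEDUP DISCLOSURE (`rg -i 'hermiteFujiwara.*submatrix|leadingMinor.*hermiteFujiwara'`, 2026-09-02): N186 ∕ N187 have the `PosDef` forms, N191 ∕ N192 the rank; no leading-minor form.  The 4 names
below: 0 hits tree-wide.

WHAT IS IN THE TREE.  N183: `hermiteFujiwara`, `hermiteFujiwara_apply`, `hermiteFujiwara_isHermitian`; N186: `posDef_hermiteFujiwara_iff`; N187: `posDef_hermiteFujiwara_real_iff`; N211:
`forall_re_neg_iff_forall_det_hurwitzMatrix_pos`; Literature: `posDef_iff_leadingMinors_pos`.
THIS FILE (namespace `Summit.Ventures.HSemireg.Wedge.HankelOuter` continued; PLAIN over N211 + Literature `SylvesterCriterion`; 0 definitions):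
* §947 `submatrix_hermiteFujiwara_castLE` (the leading `k × k` block of `H_n(p)` is `H_k(p)`), **`forall_re_neg_iff_forall_det_hermiteFujiwara_pos`** (complex `p`, `deg p = n`: Hurwitz ⟺ `det H_k(p) > 0`
  for all `k ≤ n`), **`forall_re_neg_iff_forall_det_hermiteFujiwara_pos_real`** (real `p`), `forall_det_hermiteFujiwara_pos_iff_forall_det_hurwitzMatrix_pos` (real `p`, `lc > 0`: Hermite's
  determinants are all positive iff Hurwitz's are).
CAVEATS.  Over `ℂ` the inequalities `0 < det H_k(p)` are in Mathlib's `ComplexOrder` (the determinants of Hermitian matrices are real).  Nothing Ext-side.  New names only.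
-/

open Module Polynomial
open scoped Matrix Polynomial ComplexOrder

namespace Summit.Ventures.HSemireg.Wedge.HankelOuter

open Summit.Ventures.HSemireg.Wedge Summit.Ventures.HSemireg.Wedge.Hankel

/-! ## §947. Hermite's determinants -/

/-- **The leading `k × k` block of `H_n(p)` is `H_k(p)`** (the entry `(−1)^j b_{ij}(p(−X), p̄)` does not depend on the order). [bookkeeping; this file, §947] -/
theorem submatrix_hermiteFujiwara_castLE {R : Type*} [CommRing R] [StarRing R] {k n : ℕ} (h : k ≤ n) (p : R[X]) :
    (hermiteFujiwara n p).submatrix (Fin.castLE h) (Fin.castLE h) = hermiteFujiwara k p := by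
  ext i j
  rw [Matrix.submatrix_apply, hermiteFujiwara_apply, hermiteFujiwara_apply, Fin.val_castLE, Fin.val_castLE]

/-- **HERMITE'S DETERMINANTAL TEST (complex coefficients): for `p ∈ ℂ[z]` of degree `n`, all roots lie in `Re z < 0` iff `det H_k(p) > 0` for every `k ≤ n`** (F–H Thm 5.53 `H_n(p) ≻ 0` +
Sylvester's criterion on the leading blocks `H_k(p)`). [F–H Thm 5.53 + Horn–Johnson Thm 7.2.5; this file, §947] -/
theorem forall_re_neg_iff_forall_det_hermiteFujiwara_pos {n : ℕ} {p : ℂ[X]} (hp : p.natDegree = n) :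
    (∀ z ∈ p.roots, z.re < 0) ↔ ∀ k ≤ n, 0 < (hermiteFujiwara k p).det := by
  rw [← posDef_hermiteFujiwara_iff hp, Literature.LinearAlgebra.Matrix.posDef_iff_leadingMinors_pos]
  simp only [submatrix_hermiteFujiwara_castLE]
  exact ⟨fun h => h.2, fun h => ⟨hermiteFujiwara_isHermitian n p, h⟩⟩

/-- **The same for a real polynomial** (`H_k(p)` real symmetric; N187). [F–H Thm 5.55 (i) ⟺ (ii) + Sylvester; this file, §947] -/
theorem forall_re_neg_iff_forall_det_hermiteFujiwara_pos_real {n : ℕ} {p : ℝ[X]} (hp : p.natDegree = n) :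
    (∀ z ∈ (p.map (algebraMap ℝ ℂ)).roots, z.re < 0) ↔ ∀ k ≤ n, 0 < (hermiteFujiwara k p).det := by
  rw [← posDef_hermiteFujiwara_real_iff hp, Literature.LinearAlgebra.Matrix.posDef_iff_leadingMinors_pos]
  simp only [submatrix_hermiteFujiwara_castLE]
  exact ⟨fun h => h.2, fun h => ⟨hermiteFujiwara_isHermitian n p, h⟩⟩

/-- **Hermite's determinants and Hurwitz's determinants test the same thing**: for a real `p` of degree `n` with positive leading coefficient, `det H_k(p) > 0` for all `k ≤ n` iff `Δ_k(p) > 0` for all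
`k ≤ n` (both iff `p` is Hurwitz; N211). [F–H Thm 5.53 ∕ 5.55 + Gantmacher (36); this file, §947] -/
theorem forall_det_hermiteFujiwara_pos_iff_forall_det_hurwitzMatrix_pos {n : ℕ} {p : ℝ[X]} (hp : p.natDegree = n) (hlc : 0 < p.leadingCoeff) :
    (∀ k ≤ n, 0 < (hermiteFujiwara k p).det) ↔ ∀ k ≤ n, 0 < (hurwitzMatrix k p).det := by
  rw [← forall_re_neg_iff_forall_det_hermiteFujiwara_pos_real hp, forall_re_neg_iff_forall_det_hurwitzMatrix_pos hp hlc]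

end Summit.Ventures.HSemireg.Wedge.HankelOuter
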